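import Summits.Ventures.HSemireg.WedgeHankelClassSpaceIrreducible

/-!
# Venture HSemireg — SCHUR FOR TH-7's CLASS SPACE: when `n! ≠ 0` in `K`, every endomorphism of `spikeSpan n` commuting with the shear `SbC(1 1 0 1)` and the swap `SbC(0 1 1 0)`
# is a SCALAR (no algebraic closure needed: the shear has the single eigen-line `K·E_n`, which pins the eigenvalue); in particular the only substitutions commuting with all
# substitutions on the classes act as scalars

HONEST FRAMING. Part of the Lean index of the computation cell `pub-hsemireg` (seat p10 gen 20, Sunday typer «UNIFORM-IN-n»).
Finite-dimensional EXTERIOR ALGEBRA + linear algebra ONLY: no variety, no cohomology theory, no sheaf, no Ext group, no semiregularity map;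
nothing here says that HC / HC_CM / HC_AV holds; no Literature fact is declared or used.  Custodian versions as in `WedgeHankelSiegelIdeal` (1/3) and `WedgeHankelFrameChange`;
the dictionary (`End_{SL₂}(Sym^n) = K` in characteristic `0` / `p > n`) is QUOTED, never asserted.

WHAT IS IN THE TREE.  J9 (`WedgeHankelClassSpaceIrreducible`): `eq_top_of_shear_swap_stable` (irreducibility under shear + swap for `n! ≠ 0`), `SbC_shear_one_eq_Φs`; I8 `Φs_eigen_mem_span_point`
(the shear's eigenvectors in the class space are multiples of `E_n`), `cast_succ_ne_zero_of_factorial`; I18 (the shear is unipotent).  THIS FILE (namespace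
`Summit.Ventures.HSemireg.Wedge.HankelFrameChange` continued; imports J9):
* §253 `ker_stable_of_commute` (an endomorphism commuting with `T` preserves `ker(T − c)` … stated as: `T` commuting with `A` maps `ker A` into `ker A`), `spike_top_mem_ker_shear_sub_one`
  (`E_n` is fixed by the shear), **`exists_apply_spike_top_eq_smul`** (`n! ≠ 0`: an endomorphism commuting with the shear has `E_n` as an EIGENVECTOR).
* §254 **`eq_smul_one_of_commute_shear_swap`: for `n! ≠ 0`, every `T : spikeSpan n →ₗ spikeSpan n` commuting with `SbC(1 1 0 1)` and `SbC(0 1 1 0)` is `c • 1`** (SCHUR: the eigenspace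
  `ker(T − c)` is non-zero and stable, hence everything by J9), `eq_smul_one_of_forall_commute_SbC` (commuting with every substitution), and the converse direction for the centre of
  the image: **`SbC_eq_smul_one_of_forall_commute`** (a substitution commuting with all substitutions on the classes acts as a scalar there).
NOT typed here: characteristic `p ≤ n` (the commutant can be larger when the class space is reducible, J8); anything Ext-side.  New names only.
-/

open Module

namespace Summit.Ventures.HSemireg.Wedge.HankelFrameChange

open Summit.Ventures.HSemireg.Wedge Summit.Ventures.HSemireg.Wedge.Kunneth Summit.Ventures.HSemireg.Wedge.Hankel
  Summit.Ventures.HSemireg.Wedge.BasisFree Summit.Ventures.HSemireg.Wedge.HankelSiegel Summit.Ventures.HSemireg.Wedge.HankelSiegelIdeal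
  Summit.Ventures.HSemireg.Wedge.KunnethKernel Summit.Ventures.HSemireg.Wedge.HankelRankOne Summit.Ventures.HSemireg.Wedge.KernelDuality

variable (K : Type*) [Field K] {n : ℕ}

/-! ## §253. An endomorphism commuting with the shear has the point class as an eigenvector -/

section Commute

variable {V : Type*} [AddCommGroup V] [Module K V]

/-- an endomorphism `T` commuting with `A` maps `ker A` into `ker A`. -/
theorem ker_stable_of_commute {T A : Module.End K V} (h : T * A = A * T) {v : V} (hv : v ∈ LinearMap.ker A) : T v ∈ LinearMap.ker A := by
  rw [LinearMap.mem_ker] at hv ⊢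
  rw [← Module.End.mul_apply, ← h, Module.End.mul_apply, hv, map_zero]

/-- if `T` commutes with `A` and `B`, so does `T − c`. -/
theorem sub_smul_one_commute {T A : Module.End K V} (h : T * A = A * T) (c : K) : (T - c • 1) * A = A * (T - c • 1) := by
  refine LinearMap.ext fun v => ?_
  have hv := LinearMap.congr_fun h v
  simp only [Module.End.mul_apply, LinearMap.sub_apply, LinearMap.smul_apply, Module.End.one_apply, map_sub, map_smul] at hv ⊢
  rw [hv]

end Commute

/-- the point class `E_n` is FIXED by the shear: `E_n ∈ ker(SbC(1 1 0 1) − 1)` (`∞` is fixed by every upper substitution, I4). -/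
theorem spike_top_mem_ker_shear_sub_one :
    (⟨w K n n (fun j => if j = n then (1 : K) else 0), w_mem_spikeSpan K _⟩ : spikeSpan K n) ∈ LinearMap.ker (SbC K 1 1 0 1 (n := n) - 1) := by
  rw [LinearMap.mem_ker, LinearMap.sub_apply, Module.End.one_apply, sub_eq_zero]
  apply Subtype.ext
  rw [SbC_apply_coe]
  exact (Sb_w_point_of_upper K 1 1 1 le_rfl).trans (by rw [one_pow, one_smul])

/-- **for `n! ≠ 0`: an endomorphism of the class space commuting with the shear `SbC(1 1 0 1)` has the point class `E_n` as an EIGENVECTOR** (it preserves the shear's fixed space,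
which is the line `K·E_n` by I8). -/
theorem exists_apply_spike_top_eq_smul (hfac : (n.factorial : K) ≠ 0) {T : Module.End K (spikeSpan K n)} (hT : T * SbC K 1 1 0 1 = SbC K 1 1 0 1 * T) :
    ∃ c : K, T ⟨w K n n (fun j => if j = n then (1 : K) else 0), w_mem_spikeSpan K _⟩ = c • ⟨w K n n (fun j => if j = n then (1 : K) else 0), w_mem_spikeSpan K _⟩ := by
  set En : spikeSpan K n := ⟨w K n n (fun j => if j = n then (1 : K) else 0), w_mem_spikeSpan K _⟩ with hEn
  have hN : T * (SbC K 1 1 0 1 - 1) = (SbC K 1 1 0 1 - 1) * T := by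
    refine LinearMap.ext fun v => ?_
    have hv := LinearMap.congr_fun hT v
    simp only [Module.End.mul_apply, LinearMap.sub_apply, Module.End.one_apply, map_sub] at hv ⊢
    rw [hv]
  have hmem := ker_stable_of_commute K hN (spike_top_mem_ker_shear_sub_one K (n := n))
  -- `T E_n` is fixed by the shear; if non-zero it is a multiple of `E_n` (I8), if zero take `c = 0`
  by_cases h0 : T En = 0
  · exact ⟨0, by rw [h0, zero_smul]⟩
  · have hfix : Φs K 1 ((T En : spikeSpan K n) : HT K (In n)) = (1 : K) • ((T En : spikeSpan K n) : HT K (In n)) := by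
      rw [one_smul, ← SbC_shear_one_eq_Φs]
      rw [LinearMap.mem_ker, LinearMap.sub_apply, Module.End.one_apply, sub_eq_zero] at hmem
      rw [hmem]
    have hc : ((T En : spikeSpan K n) : HT K (In n)) ∈ coSiegel K n n := by rw [← spikeSpan_eq_coSiegel]; exact (T En).2
    have h0' : ((T En : spikeSpan K n) : HT K (In n)) ≠ 0 := fun h => h0 (Subtype.ext h)
    obtain ⟨-, hspan⟩ := Φs_eigen_mem_span_point K one_ne_zero (fun i hi => cast_succ_ne_zero_of_factorial hfac hi) hc h0' hfix
    obtain ⟨c, hc'⟩ := Submodule.mem_span_singleton.mp hspan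
    exact ⟨c, Subtype.ext (by rw [Submodule.coe_smul, hc'])⟩

/-! ## §254. Schur: the commutant of shear + swap is the scalars -/

/-- **SCHUR FOR TH-7's CLASS SPACE: for `n! ≠ 0` in `K`, every endomorphism commuting with the shear `SbC(1 1 0 1)` and the swap `SbC(0 1 1 0)` is a scalar `c • 1`** — no algebraic
closure is needed: `c` is the eigenvalue on `E_n` (§253), and the eigenspace `ker(T − c)` is a non-zero subspace stable under both generators, hence everything (J9). -/
theorem eq_smul_one_of_commute_shear_swap (hfac : (n.factorial : K) ≠ 0) {T : Module.End K (spikeSpan K n)} (hU : T * SbC K 1 1 0 1 = SbC K 1 1 0 1 * T)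
    (hS : T * SbC K 0 1 1 0 = SbC K 0 1 1 0 * T) : ∃ c : K, T = c • 1 := by
  obtain ⟨c, hc⟩ := exists_apply_spike_top_eq_smul K hfac hU
  refine ⟨c, ?_⟩
  set W := LinearMap.ker (T - c • 1) with hW
  have hEn : (⟨w K n n (fun j => if j = n then (1 : K) else 0), w_mem_spikeSpan K _⟩ : spikeSpan K n) ∈ W := by
    rw [hW, LinearMap.mem_ker, LinearMap.sub_apply, LinearMap.smul_apply, Module.End.one_apply, hc, sub_self]
  have hWne : W ≠ ⊥ := fun h => by
    rw [h, Submodule.mem_bot] at hEn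
    exact w_spike_ne_zero K le_rfl (congrArg Subtype.val hEn)
  have hWU : ∀ f ∈ W, SbC K 1 1 0 1 f ∈ W := fun f hf => ker_stable_of_commute K (sub_smul_one_commute K hU c).symm hf
  have hWS : ∀ f ∈ W, SbC K 0 1 1 0 f ∈ W := fun f hf => ker_stable_of_commute K (sub_smul_one_commute K hS c).symm hf
  have htop := eq_top_of_shear_swap_stable K hfac hWU hWS hWne
  refine LinearMap.ext fun f => ?_
  have hf : f ∈ W := by rw [htop]; exact Submodule.mem_top
  rw [hW, LinearMap.mem_ker, LinearMap.sub_apply, sub_eq_zero] at hf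
  exact hf

/-- **an endomorphism commuting with EVERY substitution on the classes is a scalar** (`n! ≠ 0`). -/
theorem eq_smul_one_of_forall_commute_SbC (hfac : (n.factorial : K) ≠ 0) {T : Module.End K (spikeSpan K n)} (h : ∀ α β γ δ : K, T * SbC K α β γ δ = SbC K α β γ δ * T) :
    ∃ c : K, T = c • 1 :=
  eq_smul_one_of_commute_shear_swap K hfac (h 1 1 0 1) (h 0 1 1 0)

/-- **a substitution commuting with all substitutions ON THE CLASSES acts as a scalar there** (`n! ≠ 0`; e.g. the scalar letter maps `SbC(t 0 0 t) = t^n • 1`). -/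
theorem SbC_eq_smul_one_of_forall_commute (hfac : (n.factorial : K) ≠ 0) {α β γ δ : K} (h : ∀ α' β' γ' δ' : K, SbC K α β γ δ (n := n) * SbC K α' β' γ' δ' = SbC K α' β' γ' δ' * SbC K α β γ δ) :
    ∃ c : K, SbC K α β γ δ (n := n) = c • 1 :=
  eq_smul_one_of_forall_commute_SbC K hfac h

/-- characteristic `0`: Schur for every `n`. -/
theorem eq_smul_one_of_commute_shear_swap_charZero [CharZero K] {T : Module.End K (spikeSpan K n)} (hU : T * SbC K 1 1 0 1 = SbC K 1 1 0 1 * T)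
    (hS : T * SbC K 0 1 1 0 = SbC K 0 1 1 0 * T) : ∃ c : K, T = c • 1 :=
  eq_smul_one_of_commute_shear_swap K (Nat.cast_ne_zero.2 (Nat.factorial_ne_zero n)) hU hS

end Summit.Ventures.HSemireg.Wedge.HankelFrameChange
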